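import Summits.Ventures.PercRepro.RankLevelSetBiIndepAbsorbNormSkew
import Summits.Ventures.PercRepro.RankLevelSetMinorPairSum

/-! # RankLevelSetBiIndepAbsorbNormSkewSum — (ABS-norm) IS CLOSED UNDER DIRECT SUMS (GIVEN MONO OF THE OTHER
SUMMAND): THE ABSORBING PROFILE OF `M ⊕ N` AT `x ∈ E(M)` IS THE CONVOLUTION `A^x(M) ⋆ D(N)` (night-1 g32;
dossier §44.2)

For `x ∈ E(M)` a bi-independent set `Z` of `M ⊕ N` avoids `x` and absorbs it (`insert x Z` dependent) exactly when its
`M`-trace does (the `N`-trace is untouched: independence in a direct sum is checked trace by trace), so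
`A^x_k(M ⊕ N) = Σ_a A^x_a(M) · D_{k−a}(N)` (**`lowAbsorbCount_disjointSum`**, from g29's fibrewise product
`ncard_biIndep_disjointSum_filter_both`). g31's `normSkew_conv` then gives **`absorbNormSkew_disjointSum`**:
(ABS-norm) of `M` and of `N` together with Mono of `M` and of `N` give (ABS-norm) of `M ⊕ N` — so, as for Mono
(g31), a counterexample to (ABS-norm) inside the Mono-class can be taken CONNECTED. Every declaration has a docstring;
imports: the cell's own modules and Mathlib only. Axioms: standard. -/

namespace PercRepro

open Finset Set Matroid

variable {α : Type} {M N : Matroid α} [M.Finite] [N.Finite] {h : Disjoint M.E N.E}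

/-- **The absorbing avoid-`x` profile of a direct sum at `x ∈ E(M)` is the convolution `A^x(M) ⋆ D(N)`.** -/
theorem lowAbsorbCount_disjointSum {x : α} (hx : x ∈ M.E) (k : ℕ) :
    lowAbsorbCount (M.disjointSum N h) x k = SkewConv.conv (lowAbsorbCount M x) (biIndepCount N) k := by
  classical
  have hxN : x ∉ N.E := fun hxN => (Set.disjoint_left.mp h) hx hxN
  have hset : lowAbsorbAt (M.disjointSum N h) x k =
      {S ∈ biIndep (M.disjointSum N h) k |
        (x ∉ S ∩ M.E ∧ ¬ M.Indep (insert x (S ∩ M.E))) ∧ True} := by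
    ext S
    simp only [lowAbsorbAt, Set.mem_setOf_eq, and_true]
    constructor
    · rintro ⟨hS, hxS, hdep⟩
      refine ⟨hS, fun hx' => hxS hx'.1, fun hind => hdep ?_⟩
      obtain ⟨hSE, -, -, -⟩ := mem_biIndep_disjointSum_iff.mp hS
      obtain ⟨-, -, -, hSN⟩ := (mem_biIndep_disjointSum_iff.mp hS).2.2.2
      rw [Matroid.disjointSum_indep_iff]
      refine ⟨?_, ?_, ?_⟩
      · have e : insert x S ∩ M.E = insert x (S ∩ M.E) := by
          ext y; simp only [Set.mem_inter_iff, Set.mem_insert_iff]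
          constructor
          · rintro ⟨(rfl | hyS), hyM⟩
            · exact Or.inl rfl
            · exact Or.inr ⟨hyS, hyM⟩
          · rintro (rfl | ⟨hyS, hyM⟩)
            · exact ⟨Or.inl rfl, hx⟩
            · exact ⟨Or.inr hyS, hyM⟩
        rw [e]; exact hind
      · have e : insert x S ∩ N.E = S ∩ N.E := by
          ext y; simp only [Set.mem_inter_iff, Set.mem_insert_iff]
          constructor
          · rintro ⟨(rfl | hyS), hyN⟩
            · exact absurd hyN hxN
            · exact ⟨hyS, hyN⟩
          · rintro ⟨hyS, hyN⟩; exact ⟨Or.inr hyS, hyN⟩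
        rw [e]
        exact (mem_biIndep_disjointSum_iff.mp hS).2.2.2.2.2.1
      · exact Set.insert_subset (Or.inl hx) hSE
    · rintro ⟨hS, hxS, hdep⟩
      refine ⟨hS, fun hx' => hxS ⟨hx', hx⟩, fun hind => hdep ?_⟩
      rw [Matroid.disjointSum_indep_iff] at hind
      have e : insert x S ∩ M.E = insert x (S ∩ M.E) := by
        ext y; simp only [Set.mem_inter_iff, Set.mem_insert_iff]
        constructor
        · rintro ⟨(rfl | hyS), hyM⟩
          · exact Or.inl rfl
          · exact Or.inr ⟨hyS, hyM⟩
        · rintro (rfl | ⟨hyS, hyM⟩)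
          · exact ⟨Or.inl rfl, hx⟩
          · exact ⟨Or.inr hyS, hyM⟩
      rw [e] at hind
      exact hind.1
  unfold lowAbsorbCount SkewConv.conv
  rw [hset, ncard_biIndep_disjointSum_filter_both (fun S₁ => x ∉ S₁ ∧ ¬ M.Indep (insert x S₁)) (fun _ => True) k]
  refine Finset.sum_congr rfl fun a _ => ?_
  simp only [Set.sep_true]
  rfl

/-- **(ABS-norm) IS CLOSED UNDER DIRECT SUMS** (with Mono of both summands): `A^x(M ⊕ N) = A^x(M) ⋆ D(N)` for
`x ∈ E(M)` (and symmetrically), and `normSkew_conv` adds the parameters `#E(M) + #E(N) = #E(M ⊕ N)`. -/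
theorem absorbNormSkew_disjointSum (hM : BiIndepAbsorbNormSkew M) (hN : BiIndepAbsorbNormSkew N)
    (hMm : BiIndepMono M) (hNm : BiIndepMono N) : BiIndepAbsorbNormSkew (M.disjointSum N h) := by
  haveI : (M.disjointSum N h).Finite :=
    ⟨by rw [Matroid.disjointSum_ground_eq]; exact M.ground_finite.union N.ground_finite⟩
  have hcard : (M.disjointSum N h).E.ncard = M.E.ncard + N.E.ncard := by
    rw [Matroid.disjointSum_ground_eq, Set.ncard_union_eq h M.ground_finite N.ground_finite]
  intro x hxE
  rw [hcard]
  rw [Matroid.disjointSum_ground_eq] at hxE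
  rcases hxE with hxM | hxN
  · have hconv := SkewConv.normSkew_conv (hM x hxM) (normSkew_biIndepCount_of_mono N hNm)
    exact SkewConv.normSkew_congr hconv fun k _ => (lowAbsorbCount_disjointSum hxM k).symm
  · have hconv := SkewConv.normSkew_conv (hN x hxN) (normSkew_biIndepCount_of_mono M hMm)
    rw [Nat.add_comm]
    refine SkewConv.normSkew_congr hconv fun k _ => ?_
    rw [Matroid.disjointSum_comm]
    exact (lowAbsorbCount_disjointSum (h := h.symm) hxN k).symm

end PercRepro
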